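import Summits.Ventures.CertifiedManyBodySolver.Observables.PhaseSeparationExclusionBox
import HarnessLib
import HarnessLib.Audit

/-!
# Ventures/CertifiedManyBodySolver — Observables/PhaseSeparationExclusionVirtualColumns.lean: VIRTUAL `n = 1` COLUMNS (the `U`-chord of two landed column laws read at an
# intermediate coupling) in the COLUMN-LAW shape of the competing-order laws (hubbard-downfold-unc-2 g37, filling direction «chords / convexity»)

HONEST FRAMING: a transport (re-packaging) file, zero compute, no definition, no claim node, no number of record. PURPOSE (cell `pub/hubbard-downfold`, MO-S1 ↔ S2 seam «box ↦
one word», filling lane): every `(≤ n₁ ∣ ≥ 1)` competing-order law of this seat / hubbard-box-p3 (`ps_not_groundState_mix_on_cell_of_columns_tcap`, `psT_…_hotAnchorSS_tcap`,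
`psH_…`, `psGC_…`, `psL_…`, `…doccAnchor_tcap`) reads its two DENSE-SIDE COLUMN slots as `∀ s ∈ [s₁,s₂], Lᵢ(s) ≤ e(1, s, Uᵢ, 1)` at the cell's end couplings `U₁ < U₂` and ONE cap
plane `c₀ + c_s·s + c₁·U` for the whole cell. Where two cap families cross inside a cell — the WS597 filling-`3/4` witness-split plane (`c₁ = +0.0288`, best at the low-`U` end) and a
`U`-independent polarised-sea cap (best at the high-`U` end) — ONE cap for `[U₁,U₂]` wastes the better cap of each half: on `Q = [−1/4,−1/5] × [10,12]` the `T = 0` margins are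
`(≤1/2∣≥1)` `0.0568∣0.0588` at `U = 10` but `0.0323∣0.0348` at `U = 12` with WS597, and `0.0846∣0.0521` at `12` but `≈ 0.05∣0.02` at `10` with the polarised `3/4`∣`7/10` caps. SPLITTING
the cell at `U⋆ ∈ (U₁,U₂)` needs a column law AT `U⋆`, and `U ↦ e(1,s,U,1)` is CONCAVE (Ruelle; `energyDensityTT'_uchord_floor_of_mem_Icc`), so the `U`-chord of the two landed
laws IS one: `((U₂−U⋆)·L₁(s) + (U⋆−U₁)·L₂(s))/(U₂−U₁) ≤ e(1, s, U⋆, 1)` — `floor_on_cell_of_columnLaws` (`PhaseSeparationExclusionBox.lean`, hubbard-box-p3) read at the point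
`U⋆`. This file states that reading in the exact COLUMN-LAW shape (`vcol_of_laws`: conclusion `∀ s ∈ Icc s₁ s₂, V(s) ≤ e(1,s,U⋆,1)`), plus the point form used inside tactic
blocks (`vcol_of_laws_at`). CONSEQUENCE (exact rationals, `work/split37.py` / `pickU.py` of this seat): `Q × [10,12]` split at `U⋆ = 45/4` (`[10,45/4]` WS597 ∣ `[45/4,12]`
constant polarised `7/10` cap `polS3n0700`) `(≤1/2∣≥1) 0.0323 → 0.0410`, `(≤9/20∣≥1) 0.0405 → 0.0485` (La214E ×10's second binding cell); `R3 = [−1/5,−1/8] × [12,16]` split at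
`U⋆ = 13` (`[12,13]` WS597 ∣ `[13,16]` tilted polarised `3/4` cap) `−0.0060 → +0.0121 ∣ −0.0025 → +0.0162` (M50's top cells: first `(≤1/2∣≥1)` / `(≤9/20∣≥1)` words there).
WHAT THIS IS NOT: a certificate; a new bound (a one-line instance of the cited tree lemma); a cell word by itself; not a statement about superconductivity.

Cell `pub/hubbard-downfold` (MO-S1 ↔ S2 seam «box ↦ one word», filling lane), seat `hubbard-downfold-unc-2` (g37, `prover-hubbard-downfold-unc-2-g37-0`).
[cite: Ruelle1969, §3.3] [cite: Griffiths1966, §II]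
-/

noncomputable section

namespace Summit.Ventures.CertifiedManyBodySolver.Observables

open Literature.MathematicalPhysics.QuantumLattice Literature.MathematicalPhysics.QuantumLattice.ThermodynamicLimit Set

/-- **Virtual `n = 1` column at `U⋆ ∈ [U₁, U₂]`** from two column laws (`Lᵢ(s) ≤ e(1, s, Uᵢ, 1)` on `[s₁, s₂]`, `0 ≤ U₁ < U₂`): the `U`-chord
`((U₂ − U⋆)·L₁(s) + (U⋆ − U₁)·L₂(s))/(U₂ − U₁) ≤ e(1, s, U⋆, 1)` on `[s₁, s₂]` (concavity of `U ↦ e`; `floor_on_cell_of_columnLaws` read at the point `U⋆`) — the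
`hL₁`/`hL₂` slot shape of the column-form PS-exclusion laws. [cite: Ruelle1969, §3.3] -/
theorem vcol_of_laws {s₁ s₂ U₁ U₂ U : ℝ} {L₁ L₂ : ℝ → ℝ} (hU₁ : 0 ≤ U₁) (h12 : U₁ < U₂)
    (hL₁ : ∀ s ∈ Icc s₁ s₂, L₁ s ≤ energyDensityTT' 1 s U₁ 1) (hL₂ : ∀ s ∈ Icc s₁ s₂, L₂ s ≤ energyDensityTT' 1 s U₂ 1)
    (hU : U ∈ Icc U₁ U₂) :
    ∀ s ∈ Icc s₁ s₂, ((U₂ - U) * L₁ s + (U - U₁) * L₂ s) / (U₂ - U₁) ≤ energyDensityTT' 1 s U 1 :=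
  fun s hs => floor_on_cell_of_columnLaws 1 (n := 1) (by norm_num) (by norm_num) hU₁ h12 hL₁ hL₂ s hs U hU

/-- **Point form** of `vcol_of_laws` (for tactic blocks that hold `s` with `h₁ : s₁ ≤ s`, `h₂ : s ≤ s₂` and two column inequalities AT that `s`): from
`L₁ ≤ e(1, s, U₁, 1)`, `L₂ ≤ e(1, s, U₂, 1)` (`0 ≤ U₁ < U₂`) and `U⋆ ∈ [U₁, U₂]`, `((U₂ − U⋆)·L₁ + (U⋆ − U₁)·L₂)/(U₂ − U₁) ≤ e(1, s, U⋆, 1)`. [cite: Ruelle1969, §3.3] -/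
theorem vcol_of_laws_at {s U₁ U₂ U l₁ l₂ : ℝ} (hU₁ : 0 ≤ U₁) (h12 : U₁ < U₂)
    (h₁ : l₁ ≤ energyDensityTT' 1 s U₁ 1) (h₂ : l₂ ≤ energyDensityTT' 1 s U₂ 1) (hU : U ∈ Icc U₁ U₂) :
    ((U₂ - U) * l₁ + (U - U₁) * l₂) / (U₂ - U₁) ≤ energyDensityTT' 1 s U 1 :=
  energyDensityTT'_uchord_floor_of_mem_Icc 1 s (n := 1) (by norm_num) (by norm_num) hU₁ h12 h₁ h₂ hU

end Summit.Ventures.CertifiedManyBodySolver.Observables
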